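import Mathlib.ModelTheory.Syntax
import Mathlib.ModelTheory.Semantics
import Mathlib.ModelTheory.Satisfiability
import Mathlib.ModelTheory.Order
import Mathlib.Data.Nat.Size
import Mathlib.Tactic.FinCases
import Literature.Computability.MetaComplexity.BoundedArithSyntax
import HarnessLib

-- provenance: harness21/H21/H21/Prelude/CplxMeta/BoundedArithTheories.lean @ c3fce92 (interim HEAD d8f2665); M5 mechanical rewrite
/-!
# The theories `BASIC`, `S₂ⁱ`, `T₂ⁱ` of bounded arithmetic and `Σᵇᵢ`-definability

Trunk: CplxMeta (G14), item C14 `BoundedArithTheories` (notion `bounded_arithmetic_theories`,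
theory half; the language, standard model and the `Σᵇᵢ/Πᵇᵢ` hierarchy are in
`BoundedArithSyntax.lean`).

We define, as `Language.boundedArith.Theory`s (sets of sentences of Mathlib's first-order
syntax), Buss's base theory `BASIC` (his 32 open axioms, universally closed), the
induction-axiom formers `IND`, `PIND`, `LIND` for a formula with parameters, the corresponding
schemes over a family of formula classes, the theories `S₂ⁱ = BASIC + Σᵇᵢ-PIND`, `T₂ⁱ = BASIC + Σᵇᵢ-IND`,
`S₂ = ⋃ᵢ S₂ⁱ`, and `Σᵇᵢ`-definability of a function `f : ℕ → ℕ` in a theory `T`.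
Provability is Mathlib's semantic consequence `T ⊨ᵇ φ` (`Theory.ModelsBoundedFormula`), which
coincides with first-order provability by completeness (outline D3).

## The axioms of `BASIC` (Buss 1986, §2.2), in Buss's numbering

With `1 = S0`, `2 = S(S0)`, `2·x = (S(S0))·x`:

1. `y ≤ x → y ≤ Sx`
2. `x ≠ Sx`
3. `0 ≤ x`
4. `(x ≤ y ∧ x ≠ y) ↔ Sx ≤ y`
5. `x ≠ 0 → 2·x ≠ 0`
6. `y ≤ x ∨ x ≤ y`
7. `x ≤ y ∧ y ≤ x → x = y`
8. `x ≤ y ∧ y ≤ z → x ≤ z`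
9. `|0| = 0`
10. `x ≠ 0 → |2·x| = S|x| ∧ |S(2·x)| = S|x|`
11. `|S0| = S0`
12. `x ≤ y → |x| ≤ |y|`
13. `|x # y| = S(|x|·|y|)`
14. `0 # y = S0`
15. `x ≠ 0 → 1 # (2·x) = 2·(1 # x) ∧ 1 # S(2·x) = 2·(1 # x)`
16. `x # y = y # x`
17. `|x| = |y| → x # z = y # z`
18. `|x| = |u| + |v| → x # y = (u # y)·(v # y)`
19. `x ≤ x + y`
20. `x ≤ y ∧ x ≠ y → S(2·x) ≤ 2·y ∧ S(2·x) ≠ 2·y`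
21. `x + y = y + x`
22. `x + 0 = x`
23. `x + Sy = S(x + y)`
24. `(x + y) + z = x + (y + z)`
25. `x + y ≤ x + z ↔ y ≤ z`
26. `x·0 = 0`
27. `x·Sy = x·y + x`
28. `x·y = y·x`
29. `x·(y + z) = x·y + x·z`
30. `S0 ≤ x → (x·y ≤ x·z ↔ y ≤ z)`
31. `x ≠ 0 → |x| = S|⌊x/2⌋|`
32. `x = ⌊y/2⌋ ↔ (2·x = y ∨ S(2·x) = y)`

## Sources

* S. Buss, *Bounded Arithmetic*, Bibliopolis 1986: §2.2 (`BASIC`), §2.3–2.4 (the schemes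
  `IND`, `PIND`, `LIND` and the theories `S₂ⁱ`, `T₂ⁱ`), Ch. 5 (`Σᵇ₁`-definable functions).
* J. Krajíček, *Bounded Arithmetic, Propositional Logic and Complexity Theory*, CUP 1995,
  §5.2 (Def. 5.2.3: `BASIC`, `S₂ⁱ`, `T₂ⁱ`).

## Mathlib anchors used (verified by grep)

`Language.Theory = Set Sentence`, `BoundedFormula.alls`, `BoundedFormula.relabel`
(pattern `BoundedFormula.relabel Sum.inr φ` turning a `Formula (Fin n)` into a
`BoundedFormula Empty n`, cf. `Formula.realize_relabel_sumInr`), `BoundedFormula.subst`,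
`Term.le` (from the `IsOrdered` instance of C13), `Term.bdEqual` (`='`),
`Theory.ModelsBoundedFormula` (`⊨ᵇ`), `Theory.Model`, `Theory.Extends` (C13).
Mathlib has no induction-scheme former for `FirstOrder.Language` theories and no bounded
arithmetic (grep for `induction.*Sentence`, `Scheme` in `Mathlib/ModelTheory` finds nothing).

## Design choices

* Universal closure of a formula with free variables `Fin n` is the *computable*
  `closeFin φ := (BoundedFormula.relabel Sum.inr φ).alls` (this is what the noncomputable
  `Formula.iAlls` does after choosing `Fin n ≃ Fin n`); quantifying only the last free variable
  is `allLast`. Both are generic over the language.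
* Axiom formers take `φ : Formula (Fin (k+1))`: the induction variable is `Fin.last k`, the
  other `k` variables are parameters, universally closed at the end (Buss allows parameters).
  Instances `φ(t)` are `BoundedFormula.subst` along `Function.update Term.var (Fin.last k) t`
  (`substLast`), and `φ(t)` for a parameter-only term `t` is `instLast`.
* `BASIC` is given by an explicit list `basicAxioms` (in Buss's order), `BASIC := {φ | φ ∈ list}`.
* `model_nat_BASIC : ℕ ⊨ BASIC` is a theorem (Prop-valued class stated as a theorem, never an
  instance, per the outline).
* `IsSigmabDefinable` is stated for unary `f : ℕ → ℕ` only; `k`-ary functions are handled in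
  the literature identically and reduce to the unary case via Buss's `Σᵇ₁`-definable tupling
  (Buss 1986, §2.5); we document rather than formalise this.
* Theory names follow the G01 acronym style (`S2`, `T2`, `S2Union`, like `TC0`, `NC`).
* `S2_extends_T2` (`T₂ⁱ ⊢ S₂ⁱ`) carries the hypothesis `1 ≤ i` as in Buss's Thm. 2.6 and
  Krajíček's Lemma 5.2.5; the `i = 0` instance is not a theorem in print and is not asserted.
  `T2_extends_S2_succ` (`S₂ⁱ⁺¹ ⊢ T₂ⁱ`) holds for all `i`.
-/

namespace Literature.Computability.MetaComplexity

open FirstOrder FirstOrder.Language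

/-! ## Generic syntax helpers: closing and instantiating the last free variable -/

section Helpers

variable {L : Language} {k n : ℕ}

/-- The universal closure `∀ x₀ ⋯ ∀ xₙ₋₁ φ` of a formula whose free variables are `Fin n`, as a
sentence (computable analogue of Mathlib's `Formula.iAlls`; standard, e.g. Buss 1986, §2.2:
the axioms of `BASIC` are the universal closures of open formulas). [cite: Buss1986, §2.2: the axioms of  BASIC  are the univ] -/
def closeFin (φ : L.Formula (Fin n)) : L.Sentence :=
  (BoundedFormula.relabel Sum.inr φ).alls

/-- Universally quantify the last free variable: from `φ(p₀,…,pₖ₋₁,x)` with free variables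
`Fin (k+1)` to `∀ x φ` with free variables (parameters) `Fin k` (Buss 1986, §2.3, formulation
of the induction schemes with parameters). [cite: Buss1986, §2.3  formulation of the induction schem] -/
def allLast (φ : L.Formula (Fin (k + 1))) : L.Formula (Fin k) :=
  (BoundedFormula.relabel (fun i => finSumFinEquiv.symm i) φ).all

/-- Existentially quantify the last free variable: from `φ(p₀,…,pₖ₋₁,x)` to `∃ x φ` with free
variables `Fin k` (Buss 1986, §2.3). [cite: Buss1986, §2.3] -/
def exLast (φ : L.Formula (Fin (k + 1))) : L.Formula (Fin k) :=
  (BoundedFormula.relabel (fun i => finSumFinEquiv.symm i) φ).ex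

/-- Substitute the term `t` (which may itself mention the last variable, e.g. `S x`, `⌊x/2⌋`,
`|x|`) for the last free variable `x = Fin.last k` of `φ`: `φ(x) ↦ φ(t)` (Buss 1986, §2.3). [cite: Buss1986, §2.3] -/
def substLast (φ : L.Formula (Fin (k + 1))) (t : L.Term (Fin (k + 1))) : L.Formula (Fin (k + 1)) :=
  φ.subst (Function.update Term.var (Fin.last k) t)

/-- Instantiate the last free variable of `φ` at a term `t` in the parameters only, dropping
that variable: `φ(p̄, x) ↦ φ(p̄, t(p̄))`, e.g. `φ(0)` (Buss 1986, §2.3). [cite: Buss1986, §2.3] -/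
def instLast (φ : L.Formula (Fin (k + 1))) (t : L.Term (Fin k)) : L.Formula (Fin k) :=
  φ.subst (Fin.snoc (α := fun _ => L.Term (Fin k)) Term.var t)

variable {M : Type} [L.Structure M]

/-- Semantics of the universal closure: `M ⊨ closeFin φ` iff `φ` holds under every assignment
(cf. Mathlib `Formula.realize_relabel_sumInr`, `BoundedFormula.realize_alls`). [folklore] -/
theorem realize_closeFin (φ : L.Formula (Fin n)) :
    M ⊨ closeFin φ ↔ ∀ v : Fin n → M, φ.Realize v := by
  change Formula.Realize (BoundedFormula.relabel Sum.inr φ).alls (default : Empty → M) ↔ _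
  rw [BoundedFormula.realize_alls]
  exact forall_congr' fun v => Formula.realize_relabel_sumInr φ

/-- Semantics of `allLast`: `(∀ x φ)(p̄)` holds iff `φ(p̄, a)` holds for all `a`. [folklore] -/
theorem realize_allLast (φ : L.Formula (Fin (k + 1))) (v : Fin k → M) :
    (allLast φ).Realize v ↔ ∀ a, φ.Realize (Fin.snoc v a) := by
  simp only [allLast, Formula.Realize, BoundedFormula.realize_all,
    BoundedFormula.realize_relabel, Nat.add_zero, Fin.castAdd_zero, Fin.cast_refl,
    Function.comp_id]
  refine forall_congr' fun a => ?_
  congr! 1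
  ext i
  cases i using Fin.lastCases
  · simp
    rfl
  · simp

/-- Semantics of `instLast`: `φ(p̄, t(p̄))` holds iff `φ(p̄, a)` holds for `a` the value of
`t` (cf. Mathlib `BoundedFormula.realize_subst`). [folklore] -/
theorem realize_instLast (φ : L.Formula (Fin (k + 1))) (t : L.Term (Fin k)) (v : Fin k → M) :
    (instLast φ t).Realize v ↔ φ.Realize (Fin.snoc v (t.realize v)) := by
  simp only [instLast, Formula.Realize, BoundedFormula.realize_subst]
  congr! 1
  ext i
  cases i using Fin.lastCases <;> simp

/-- Semantics of `substLast`: `φ(p̄, t(p̄, x))` holds at `v` iff `φ` holds at `v` with the last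
value replaced by the value of `t` (cf. Mathlib `BoundedFormula.realize_subst`). [folklore] -/
theorem realize_substLast (φ : L.Formula (Fin (k + 1))) (t : L.Term (Fin (k + 1)))
    (v : Fin (k + 1) → M) :
    (substLast φ t).Realize v ↔ φ.Realize (Function.update v (Fin.last k) (t.realize v)) := by
  simp only [substLast, Formula.Realize, BoundedFormula.realize_subst]
  congr! 1
  ext i
  by_cases h : i = Fin.last k
  · subst h
    simp
  · simp [Function.update_of_ne h]

end Helpers

/-! ## `BASIC` -/

section BASIC

open BoundedFormula

/-- Buss's 32 open axioms of `BASIC`, universally closed, listed in Buss's numbering (see the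
module docstring for the informal list; Buss 1986, §2.2; Krajíček 1995, Def. 5.2.3). Bound
variables: `x = &0`, `y = &1`, `z = &2` (in axiom 18: `x = &0`, `y = &1`, `u = &2`, `v = &3`);
`1 = natConst 1 = S0`, `2 = natConst 2 = S(S0)`; `≤` is Mathlib's `Term.le`. [cite: Buss1986, §2.2] -/
def basicAxioms : List Language.boundedArith.Sentence :=
  [ -- (1) y ≤ x → y ≤ Sx
    alls (n := 2) (Term.le &1 &0 ⟹ Term.le &1 (Term.succ &0)),
    -- (2) x ≠ Sx
    alls (n := 1) (∼(&0 =' Term.succ &0)),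
    -- (3) 0 ≤ x
    alls (n := 1) (Term.le 0 &0),
    -- (4) (x ≤ y ∧ x ≠ y) ↔ Sx ≤ y
    alls (n := 2) ((Term.le &0 &1 ⊓ ∼(&0 =' &1)) ⇔ Term.le (Term.succ &0) &1),
    -- (5) x ≠ 0 → 2·x ≠ 0
    alls (n := 1) (∼(&0 =' 0) ⟹ ∼((natConst 2 * &0) =' 0)),
    -- (6) y ≤ x ∨ x ≤ y
    alls (n := 2) (Term.le &1 &0 ⊔ Term.le &0 &1),
    -- (7) x ≤ y ∧ y ≤ x → x = y
    alls (n := 2) (Term.le &0 &1 ⊓ Term.le &1 &0 ⟹ (&0 =' &1)),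
    -- (8) x ≤ y ∧ y ≤ z → x ≤ z
    alls (n := 3) (Term.le &0 &1 ⊓ Term.le &1 &2 ⟹ Term.le &0 &2),
    -- (9) |0| = 0
    alls (n := 0) (Term.len 0 =' 0),
    -- (10) x ≠ 0 → |2·x| = S|x| ∧ |S(2·x)| = S|x|
    alls (n := 1) (∼(&0 =' 0) ⟹
      ((Term.len (natConst 2 * &0) =' Term.succ (Term.len &0)) ⊓
        (Term.len (Term.succ (natConst 2 * &0)) =' Term.succ (Term.len &0)))),
    -- (11) |S0| = S0
    alls (n := 0) (Term.len (natConst 1) =' natConst 1),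
    -- (12) x ≤ y → |x| ≤ |y|
    alls (n := 2) (Term.le &0 &1 ⟹ Term.le (Term.len &0) (Term.len &1)),
    -- (13) |x # y| = S(|x|·|y|)
    alls (n := 2) (Term.len (Term.smash &0 &1) =' Term.succ (Term.len &0 * Term.len &1)),
    -- (14) 0 # y = S0
    alls (n := 1) (Term.smash 0 &0 =' natConst 1),
    -- (15) x ≠ 0 → 1 # (2·x) = 2·(1 # x) ∧ 1 # S(2·x) = 2·(1 # x)
    alls (n := 1) (∼(&0 =' 0) ⟹
      ((Term.smash (natConst 1) (natConst 2 * &0) =' (natConst 2 * Term.smash (natConst 1) &0)) ⊓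
        (Term.smash (natConst 1) (Term.succ (natConst 2 * &0)) ='
          (natConst 2 * Term.smash (natConst 1) &0)))),
    -- (16) x # y = y # x
    alls (n := 2) (Term.smash &0 &1 =' Term.smash &1 &0),
    -- (17) |x| = |y| → x # z = y # z
    alls (n := 3) ((Term.len &0 =' Term.len &1) ⟹ (Term.smash &0 &2 =' Term.smash &1 &2)),
    -- (18) |x| = |u| + |v| → x # y = (u # y)·(v # y)
    alls (n := 4) ((Term.len &0 =' (Term.len &2 + Term.len &3)) ⟹
      (Term.smash &0 &1 =' (Term.smash &2 &1 * Term.smash &3 &1))),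
    -- (19) x ≤ x + y
    alls (n := 2) (Term.le &0 (&0 + &1)),
    -- (20) x ≤ y ∧ x ≠ y → S(2·x) ≤ 2·y ∧ S(2·x) ≠ 2·y
    alls (n := 2) (Term.le &0 &1 ⊓ ∼(&0 =' &1) ⟹
      (Term.le (Term.succ (natConst 2 * &0)) (natConst 2 * &1) ⊓
        ∼(Term.succ (natConst 2 * &0) =' (natConst 2 * &1)))),
    -- (21) x + y = y + x
    alls (n := 2) ((&0 + &1) =' (&1 + &0)),
    -- (22) x + 0 = x
    alls (n := 1) ((&0 + 0) =' &0),
    -- (23) x + Sy = S(x + y)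
    alls (n := 2) ((&0 + Term.succ &1) =' Term.succ (&0 + &1)),
    -- (24) (x + y) + z = x + (y + z)
    alls (n := 3) ((&0 + &1 + &2) =' (&0 + (&1 + &2))),
    -- (25) x + y ≤ x + z ↔ y ≤ z
    alls (n := 3) (Term.le (&0 + &1) (&0 + &2) ⇔ Term.le &1 &2),
    -- (26) x·0 = 0
    alls (n := 1) ((&0 * 0) =' 0),
    -- (27) x·Sy = x·y + x
    alls (n := 2) ((&0 * Term.succ &1) =' (&0 * &1 + &0)),
    -- (28) x·y = y·x
    alls (n := 2) ((&0 * &1) =' (&1 * &0)),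
    -- (29) x·(y + z) = x·y + x·z
    alls (n := 3) ((&0 * (&1 + &2)) =' (&0 * &1 + &0 * &2)),
    -- (30) S0 ≤ x → (x·y ≤ x·z ↔ y ≤ z)
    alls (n := 3) (Term.le (natConst 1) &0 ⟹ (Term.le (&0 * &1) (&0 * &2) ⇔ Term.le &1 &2)),
    -- (31) x ≠ 0 → |x| = S|⌊x/2⌋|
    alls (n := 1) (∼(&0 =' 0) ⟹ (Term.len &0 =' Term.succ (Term.len (Term.half &0)))),
    -- (32) x = ⌊y/2⌋ ↔ (2·x = y ∨ S(2·x) = y)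
    alls (n := 2) ((&0 =' Term.half &1) ⇔
      (((natConst 2 * &0) =' &1) ⊔ (Term.succ (natConst 2 * &0) =' &1))) ]

/-- Buss's base theory `BASIC` of bounded arithmetic: the set of (universal closures of) his 32
open axioms `basicAxioms` fixing the basic properties of `0, S, ⌊·/2⌋, |·|, +, ·, #, ≤`
(Buss 1986, §2.2; Krajíček 1995, Def. 5.2.3). [cite: Buss1986, §2.2] -/
def BASIC : Language.boundedArith.Theory :=
  {φ | φ ∈ basicAxioms}

/-- `BASIC` has exactly Buss's 32 axioms (Buss 1986, §2.2). [cite: Buss1986, §2.2] -/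
theorem length_basicAxioms : basicAxioms.length = 32 := rfl

/-- The standard model `ℕ` is a model of `BASIC` (Buss 1986, §2.2: all axioms of `BASIC` are
true in `ℕ`). Stated as a theorem, not an instance. [cite: Buss1986, §2.2: all axioms of  BASIC  are true in] -/
def model_nat_BASIC : Prop :=
  ℕ ⊨ BASIC

end BASIC

/-! ## Induction axioms and schemes -/

section Schemes

variable {k : ℕ}

/-- The last free variable `x = Fin.last k` of a formula with free variables `Fin (k+1)`, as a
term (the induction variable of the schemes below; Buss 1986, §2.3). [cite: Buss1986, §2.3] -/
def lastVar : Language.boundedArith.Term (Fin (k + 1)) :=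
  Term.var (Fin.last k)

/-- The induction axiom `IND` for `φ(p̄, x)` (induction on the last variable `x`, parameters
`p̄` universally closed): `∀ p̄ [ φ(0) ∧ ∀ x (φ(x) → φ(S x)) → ∀ x φ(x) ]`
(Buss 1986, §2.3; Krajíček 1995, Def. 5.2.3). [cite: Buss1986, §2.3] -/
def indAxiom (φ : Language.boundedArith.Formula (Fin (k + 1))) : Language.boundedArith.Sentence :=
  closeFin
    ((instLast φ 0 ⊓ allLast (φ ⟹ substLast φ (Term.succ lastVar))) ⟹ allLast φ)

/-- The polynomial induction axiom `PIND` for `φ(p̄, x)`: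
`∀ p̄ [ φ(0) ∧ ∀ x (φ(⌊x/2⌋) → φ(x)) → ∀ x φ(x) ]` (Buss 1986, §2.3; Krajíček 1995,
Def. 5.2.3). [cite: Buss1986, §2.3] -/
def pindAxiom (φ : Language.boundedArith.Formula (Fin (k + 1))) :
    Language.boundedArith.Sentence :=
  closeFin
    ((instLast φ 0 ⊓ allLast (substLast φ (Term.half lastVar) ⟹ φ)) ⟹ allLast φ)

/-- The length induction axiom `LIND` for `φ(p̄, x)`:
`∀ p̄ [ φ(0) ∧ ∀ x (φ(x) → φ(S x)) → ∀ x φ(|x|) ]` (Buss 1986, §2.3; Krajíček 1995,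
Def. 5.2.3). [cite: Buss1986, §2.3] -/
def lindAxiom (φ : Language.boundedArith.Formula (Fin (k + 1))) :
    Language.boundedArith.Sentence :=
  closeFin
    ((instLast φ 0 ⊓ allLast (φ ⟹ substLast φ (Term.succ lastVar))) ⟹
      allLast (substLast φ (Term.len lastVar)))

/-- The scheme `Φ-IND`: all induction axioms `indAxiom φ` for `φ` in the family of formula
classes `Φ` (indexed by the number `k` of parameters) (Buss 1986, §2.3). [cite: Buss1986, §2.3] -/
def INDScheme (Φ : ∀ k, Set (Language.boundedArith.Formula (Fin (k + 1)))) :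
    Language.boundedArith.Theory :=
  ⋃ k, indAxiom '' Φ k

/-- The scheme `Φ-PIND`: all polynomial induction axioms `pindAxiom φ` for `φ` in the family
`Φ` (Buss 1986, §2.3). [cite: Buss1986, §2.3] -/
def PINDScheme (Φ : ∀ k, Set (Language.boundedArith.Formula (Fin (k + 1)))) :
    Language.boundedArith.Theory :=
  ⋃ k, pindAxiom '' Φ k

/-- The scheme `Φ-LIND`: all length induction axioms `lindAxiom φ` for `φ` in the family `Φ`
(Buss 1986, §2.3). [cite: Buss1986, §2.3] -/
def LINDScheme (Φ : ∀ k, Set (Language.boundedArith.Formula (Fin (k + 1)))) :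
    Language.boundedArith.Theory :=
  ⋃ k, lindAxiom '' Φ k

/-- The family of `Σᵇᵢ` formulas with free variables `Fin (k+1)` (`k` parameters and one
distinguished variable), for use in the schemes (Buss 1986, §2.1, §2.3). [cite: Buss1986, §2.1  §2.3] -/
def sigmabFormulas (i : ℕ) : ∀ k, Set (Language.boundedArith.Formula (Fin (k + 1))) :=
  fun _ => {φ | IsSigmab i φ}

/-- The family of `Πᵇᵢ` formulas with free variables `Fin (k+1)` (Buss 1986, §2.1, §2.3). [cite: Buss1986, §2.1  §2.3] -/
def pibFormulas (i : ℕ) : ∀ k, Set (Language.boundedArith.Formula (Fin (k + 1))) :=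
  fun _ => {φ | IsPib i φ}

variable {Φ Ψ : ∀ k, Set (Language.boundedArith.Formula (Fin (k + 1)))}

/-- Schemes are monotone in the formula class. [folklore] -/
theorem INDScheme_mono (h : ∀ k, Φ k ⊆ Ψ k) : INDScheme Φ ⊆ INDScheme Ψ :=
  Set.iUnion_mono fun k => Set.image_mono (h k)

/-- Schemes are monotone in the formula class. [folklore] -/
theorem PINDScheme_mono (h : ∀ k, Φ k ⊆ Ψ k) : PINDScheme Φ ⊆ PINDScheme Ψ :=
  Set.iUnion_mono fun k => Set.image_mono (h k)

/-- Schemes are monotone in the formula class. [folklore] -/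
theorem LINDScheme_mono (h : ∀ k, Φ k ⊆ Ψ k) : LINDScheme Φ ⊆ LINDScheme Ψ :=
  Set.iUnion_mono fun k => Set.image_mono (h k)

/-- The families `Σᵇᵢ` are cumulative in `i` (Buss 1986, §2.1; from `IsSigmab.mono`). [cite: Buss1986, §2.1] -/
def sigmabFormulas_mono : Prop :=
  ∀ {i j : ℕ} (hij : i ≤ j) (k : ℕ),
    sigmabFormulas i k ⊆ sigmabFormulas j k

/- interim proof relied on results that are now named facts (D-0014); demoted to a fact by the M5 import, proof preserved:
:=
  fun _ hφ => IsSigmab.mono hij hφ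
-/

end Schemes

/-! ## The theories `S₂ⁱ`, `T₂ⁱ`, `S₂` -/

section Theories

/-- Buss's theory `S₂ⁱ = BASIC + Σᵇᵢ-PIND` (Buss 1986, §2.4; Krajíček 1995, Def. 5.2.3). [cite: Buss1986, §2.4] -/
def S2 (i : ℕ) : Language.boundedArith.Theory :=
  BASIC ∪ PINDScheme (sigmabFormulas i)

/-- Buss's theory `T₂ⁱ = BASIC + Σᵇᵢ-IND` (Buss 1986, §2.4; Krajíček 1995, Def. 5.2.3). [cite: Buss1986, §2.4] -/
def T2 (i : ℕ) : Language.boundedArith.Theory :=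
  BASIC ∪ INDScheme (sigmabFormulas i)

/-- Buss's theory `S₂ = ⋃ᵢ S₂ⁱ` (Buss 1986, §2.4; Krajíček 1995, §5.2). As a set of axioms
this differs from `T₂ = ⋃ᵢ T₂ⁱ`, but the two are equivalent theories (same consequences), by
`T2_extends_S2_succ` (all `i`) and `S2_extends_T2` (`i ≥ 1`). [cite: Buss1986, §2.4] -/
def S2Union : Language.boundedArith.Theory :=
  ⋃ i, S2 i

/-- `BASIC ⊆ S₂ⁱ` (Buss 1986, §2.4). [cite: Buss1986, §2.4] -/
theorem BASIC_subset_S2 (i : ℕ) : BASIC ⊆ S2 i :=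
  Set.subset_union_left

/-- `BASIC ⊆ T₂ⁱ` (Buss 1986, §2.4). [cite: Buss1986, §2.4] -/
theorem BASIC_subset_T2 (i : ℕ) : BASIC ⊆ T2 i :=
  Set.subset_union_left

/-- `S₂ⁱ ⊆ S₂ʲ` for `i ≤ j`, axiom-wise (Buss 1986, §2.4). [cite: Buss1986, §2.4] -/
def S2_mono : Prop :=
  ∀ {i j : ℕ} (h : i ≤ j),
    S2 i ⊆ S2 j

/- interim proof relied on results that are now named facts (D-0014); demoted to a fact by the M5 import, proof preserved:
:=
  Set.union_subset_union_right _ (PINDScheme_mono (sigmabFormulas_mono h))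
-/

/-- `T₂ⁱ ⊆ T₂ʲ` for `i ≤ j`, axiom-wise (Buss 1986, §2.4). [cite: Buss1986, §2.4] -/
def T2_mono : Prop :=
  ∀ {i j : ℕ} (h : i ≤ j),
    T2 i ⊆ T2 j

/- interim proof relied on results that are now named facts (D-0014); demoted to a fact by the M5 import, proof preserved:
:=
  Set.union_subset_union_right _ (INDScheme_mono (sigmabFormulas_mono h))
-/

/-- `S₂ⁱ ⊆ S₂` (Buss 1986, §2.4). [cite: Buss1986, §2.4] -/
theorem S2_subset_S2Union (i : ℕ) : S2 i ⊆ S2Union :=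
  Set.subset_iUnion S2 i

/-- `T₂ⁱ` extends `S₂ⁱ` for `i ≥ 1`: `Σᵇᵢ-PIND` is derivable from `Σᵇᵢ-IND` over `BASIC`
(Buss 1986, Thm. 2.6 / §2.6 and its corollary `S₂ⁱ ⊆ T₂ⁱ`; Krajíček 1995, Lemma 5.2.5; both
stated for `i ≥ 1`). The case `i = 0` (`T₂⁰ ⊢ Σᵇ₀-PIND`?) is *not* claimed: it is not a theorem
of the cited sources (sharply bounded theories in Buss's language are pathological, cf.
Takeuti 1990, Johannsen 1995). [cite: Buss1986, Thm. 2.6 / §2.6 and its corollary  S₂ⁱ ⊆] -/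
def S2_extends_T2 : Prop :=
  ∀ {i : ℕ} (hi : 1 ≤ i),
    (S2 i).Extends (T2 i)

/-- `T₂ⁱ⁺¹` extends `S₂ⁱ⁺¹` for every `i` (successor form of `S2_extends_T2`; Buss 1986,
Thm. 2.6; Krajíček 1995, Lemma 5.2.5). [cite: Buss1986, Thm. 2.6] -/
def S2_succ_extends_T2_succ : Prop :=
  ∀ (i : ℕ),
    (S2 (i + 1)).Extends (T2 (i + 1))

/- interim proof relied on results that are now named facts (D-0014); demoted to a fact by the M5 import, proof preserved:
:=
  S2_extends_T2 (Nat.succ_pos i)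
-/

/-- `S₂ⁱ⁺¹` extends `T₂ⁱ`: `Σᵇᵢ-IND` is derivable from `Σᵇᵢ₊₁-PIND` over `BASIC`
(Buss 1986, §2.6, Cor. 2.16; Krajíček 1995, Thm. 5.2.7). [cite: Buss1986, §2.6  Cor. 2.16] -/
def T2_extends_S2_succ : Prop :=
  ∀ (i : ℕ),
    (T2 i).Extends (S2 (i + 1))

/-- The standard model `ℕ` is a model of every `S₂ⁱ` (Buss 1986, §2.4). Stated as a theorem,
not an instance. [cite: Buss1986, §2.4] -/
def model_nat_S2 : Prop :=
  ∀ (i : ℕ),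
    ℕ ⊨ S2 i

/-- The standard model `ℕ` is a model of every `T₂ⁱ` (Buss 1986, §2.4). Stated as a theorem,
not an instance. [cite: Buss1986, §2.4] -/
def model_nat_T2 : Prop :=
  ∀ (i : ℕ),
    ℕ ⊨ T2 i

end Theories

/-! ## `Σᵇᵢ`-definable functions -/

section Definability

/-- The totality sentence `∀ x ∃ y φ(x, y)` of a formula `φ` with free variables
`x = 0, y = 1 : Fin 2` (Buss 1986, Ch. 5, definition of `Σᵇ₁`-definability). [cite: Buss1986, Ch. 5  definition of  Σᵇ₁ -definability] -/
def totalitySentence (φ : Language.boundedArith.Formula (Fin 2)) :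
    Language.boundedArith.Sentence :=
  ∀' ∃' (BoundedFormula.relabel (n := 2) Sum.inr φ)

/-- The uniqueness sentence `∀ x y y' (φ(x, y) → φ(x, y') → y = y')` of a formula `φ` with
free variables `x = 0, y = 1 : Fin 2` (bound variables `x = &0, y = &1, y' = &2`)
(Buss 1986, Ch. 5, definition of `Σᵇ₁`-definability). [cite: Buss1986, Ch. 5  definition of  Σᵇ₁ -definability] -/
def uniquenessSentence (φ : Language.boundedArith.Formula (Fin 2)) :
    Language.boundedArith.Sentence :=
  ∀' ∀' ∀'
    (BoundedFormula.relabel (fun i => Sum.inr (![0, 1] i : Fin 3)) φ ⟹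
      BoundedFormula.relabel (fun i => Sum.inr (![0, 2] i : Fin 3)) φ ⟹ (&1 =' &2))

/-- `Σᵇᵢ`-definability of a unary function in a theory `T` of bounded arithmetic: there is a
`Σᵇᵢ` formula `φ(x, y)` defining the graph of `f` in the standard model `ℕ` such that `T`
proves (`⊨ᵇ`, semantic consequence) `∀ x ∃ y φ(x, y)` and `∀ x y y' (φ(x,y) → φ(x,y') → y = y')`
(Buss 1986, Ch. 5, Definition; Krajíček 1995, Def. 5.2.8 area). The graph condition is the
one-directional `φ(a, f a)` (Krajíček's form); together with the totality and uniqueness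
clauses it is equivalent to Buss's "`φ` defines the graph of `f` in `ℕ`" whenever `ℕ ⊨ T`
(all intended uses: `S2 i`, `T2 i`), differing only for unsound `T`. Only unary `f : ℕ → ℕ`
is formalised; `k`-ary functions reduce to this case by Buss's `Σᵇ₁`-definable tupling
(Buss 1986, §2.5). [cite: Buss1986, Ch. 5  Definition] -/
def IsSigmabDefinable (T : Language.boundedArith.Theory) (i : ℕ) (f : ℕ → ℕ) : Prop :=
  ∃ φ : Language.boundedArith.Formula (Fin 2),
    IsSigmab i φ ∧ (∀ a : ℕ, φ.Realize ![a, f a]) ∧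
      T ⊨ᵇ totalitySentence φ ∧ T ⊨ᵇ uniquenessSentence φ

variable {T T' : Language.boundedArith.Theory} {i j : ℕ} {f : ℕ → ℕ}

/-- Semantics of the totality sentence in `ℕ` (sanity lemma). [folklore] -/
theorem realize_totalitySentence (φ : Language.boundedArith.Formula (Fin 2)) :
    (ℕ ⊨ totalitySentence φ) ↔ ∀ a : ℕ, ∃ b : ℕ, φ.Realize ![a, b] := by
  simp only [totalitySentence, Sentence.Realize, Formula.Realize, BoundedFormula.realize_all,
    BoundedFormula.realize_ex, BoundedFormula.realize_relabel, Nat.add_zero, Fin.castAdd_zero,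
    Fin.cast_refl, Function.comp_id, Sum.elim_comp_inr]
  refine forall_congr' fun a => exists_congr fun b => ?_
  congr! 1
  ext i; fin_cases i <;> rfl

/-- Semantics of the uniqueness sentence in `ℕ` (sanity lemma). [folklore] -/
theorem realize_uniquenessSentence (φ : Language.boundedArith.Formula (Fin 2)) :
    (ℕ ⊨ uniquenessSentence φ) ↔
      ∀ a b b' : ℕ, φ.Realize ![a, b] → φ.Realize ![a, b'] → b = b' := by
  simp only [uniquenessSentence, Sentence.Realize, Formula.Realize, BoundedFormula.realize_all,
    BoundedFormula.realize_imp, BoundedFormula.realize_relabel, Nat.add_zero, Fin.castAdd_zero,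
    Fin.cast_refl, Function.comp_id, BoundedFormula.realize_bdEqual]
  refine forall_congr' fun a => forall_congr' fun b => forall_congr' fun b' =>
    imp_congr ?_ (imp_congr ?_ Iff.rfl)
  · congr! 1
    ext i; fin_cases i <;> rfl
  · congr! 1
    ext i; fin_cases i <;> rfl

/-- `Σᵇᵢ`-definability is preserved under passing to an extension theory (immediate from
`Theory.Extends.models`; Buss 1986, Ch. 5). [cite: Buss1986, Ch. 5] -/
theorem IsSigmabDefinable.mono_theory (h : T.Extends T') (hf : IsSigmabDefinable T i f) :
    IsSigmabDefinable T' i f := by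
  obtain ⟨φ, hφ, hreal, htot, huniq⟩ := hf
  exact ⟨φ, hφ, hreal, h.models htot, h.models huniq⟩

/-- `Σᵇᵢ`-definability is monotone in the level `i` (from `IsSigmab.mono`; Buss 1986, Ch. 5). [cite: Buss1986, Ch. 5] -/
def IsSigmabDefinable.mono_level : Prop :=
  ∀ (hij : i ≤ j) (hf : IsSigmabDefinable T i f),
    IsSigmabDefinable T j f

/- interim proof relied on results that are now named facts (D-0014); demoted to a fact by the M5 import, proof preserved:
:= by
  obtain ⟨φ, hφ, hreal, htot, huniq⟩ := hf
  exact ⟨φ, hφ.mono hij, hreal, htot, huniq⟩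
-/

/-- `Σᵇᵢ`-definability is monotone along inclusions of theories (Buss 1986, Ch. 5). [cite: Buss1986, Ch. 5] -/
theorem IsSigmabDefinable.mono_subset (h : T ⊆ T') (hf : IsSigmabDefinable T i f) :
    IsSigmabDefinable T' i f :=
  hf.mono_theory (Theory.Extends.of_subset h)

end Definability

end Literature.Computability.MetaComplexity
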